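import Mathlib.Data.Set.Finite.List
import Literature.Computability.Cryptography.ZhandryPRFMod
import Literature.Computability.Cryptography.ClassBQP
import Literature.Computability.Complexity.CircuitClasses
import HarnessLib

/-!
# The oracle of Aaronson–Chen 2017, Thm. 7.6 (from Zhandry's `PRP^raw` / `PRF^mod`): encoding and the three leaves

Topic `Literature/Computability/Cryptography`; second layer (after `ZhandryPRFMod.lean`) below the
leaf `Literature.Barriers.QuantumAdvantage.aaronsonChen2017_thm76_of_prp`
(`PRPExist → ∃ O ∈ P/poly, BPP^O ≠ BQP^O`) of
`Literature/Barriers/QuantumAdvantage/PPolyOraclesProofs.lean`. The diagonalization that assembles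
Thm. 7.6 from the leaves of this file and of `ZhandryPRFMod.lean` is PROVED in
`Literature/Barriers/QuantumAdvantage/PPolyOraclesThm76.lean`.

**The printed proof** (S. Aaronson, L. Chen, CCC 2017, arXiv:1612.05903 [AaronsonChen2017], whose
numbering we follow; read via `lit read arxiv:1612.05903`, pp. 29–30 and App. 13, p. 42). Thm. 7.6
(p. 30): "The oracle `O` will encode the truth tables of functions `f₁, f₂, …`, where each `f_n` is
a function from `X^raw_n` to `X^raw_n`. For each `n`, with probability `0.5` we draw `f_n` from
`PRP^raw_{K^raw}` … and with probability `0.5` we draw `f_n` from `PRF^mod_{K^mod}` similarly. We set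
`L` to be the unary language consisting of all `0ⁿ` for which `f_n` is drawn from `PRP^raw`. By
Lemma 7.5, there exists a `BQP` machine `M^O` that decides `L` correctly on all but finite many
values of `n` … On the other hand, again by Lemma 7.5, no `BPP` machine can distinguish
`PRP^raw_{K^raw}` and `PRF^mod_{K^mod}` with a non-negligible advantage. So let `M` be a `BPP`
machine … Finally, note that each `f_n` has a polynomial-size circuit, and consequently
`O ∈ P/poly`." Lemma 7.5 (2)–(3) (p. 30; App. 13, p. 42): "Given oracle access to `PRF^mod_{(k,a)}`
… there is a quantum algorithm that can recover `a` … Since `g` is a permutation, there is no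
collision … `f = g_{mod a}` has a unique period `a`. Therefore, we can apply Boneh and Lipton's
quantum period-finding algorithm … our distinguisher `A` tries to recover a period `a` … and
accepts only if `f(1) = f(1 + a)`. When `f ← PRP^raw`, `f` is a permutation, which means `A`
accepts with probability `0`."

**What this file adds** (definitions with API, and three named facts in the tree's models).

* The ENCODING of the oracle as a language (`Language Bool`, the argument type of `BQPRel`,
  `PPoly` and `Oracle.ofLanguage`): level `n` is addressed by the prefix `1ⁿ` under `boolPair`
  (`levelDomain n`); it carries the *announcement* strings `ancStr n i = ⟨1ⁿ, 0·1ⁱ⟩`, present iff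
  `i < j` (`j` = the block length of level `n`, which the machines must be told since the tree's
  `PRPExist` does not make `ℓ` computable), and the *value* strings
  `qryStr n x i = ⟨1ⁿ, 1·⟨x, 1ⁱ⟩⟩`, present iff `|x| = j`, `i < j` and bit `i` of `f_n(x)` is `1`
  (`levelStrings n j f`). A level is filled by a `LevelContent`: `prp k` (`f_n = PRP^raw_k` on
  `{0,1}^{ℓ n}`), `prfmod k a` (`f_n = PRF^mod_{(k,a)}`), or `filler` (the identity permutation of
  `{0,1}ⁿ`; the deterministic diagonalization of the Barriers file leaves all levels it does not
  treat as `filler`, which a uniform adversary can compute and which the `BQP` machine accepts).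
  `zhandryOracle F ℓ C` is the oracle of the content assignment `C : ℕ → LevelContent`;
  `specLang E T n j f` is the shape of the oracle seen by a stage of the diagonalization (a finite
  hard-wired part `T` at the finitely many treated levels `E`, the level `n` under test, fillers
  elsewhere).
* `aaronsonChen2017_lem75_quantum` — Lemma 7.5 (2)–(3) in the `BQP^O` model `BQPRel` (Q2: uniform
  Clifford+T families with XOR query gates): a uniform family which, at every large level, accepts
  with probability `≥ 2/3` when the level function is injective (a permutation has no collision)
  and `≤ 1/3` when it is `g ∘ (· mod a)` for an injective `g` and a modulus `a ∈ A` (period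
  finding plus the collision test), uniformly in the key — the form the printed proof establishes.
* `aaronsonChen2017_thm76_bppMachine` — "let `M` be a `BPP` machine": a `BPP^O` machine, run at
  the probe `1ⁿ` against an oracle of shape `specLang E T n j f`, IS a probabilistic
  polynomial-time oracle adversary against `f` (C4a `OracleAdversary`, the adversaries of the
  tree's `IsPRP`/`IsPRF`), with the same acceptance probability (folklore simulation,
  Arora–Barak 2009, §3.4 with Def. 7.3; the hard-wired finite part is what makes the reduction
  uniform).
* `aaronsonChen2017_thm76_memPPoly` — "each `f_n` has a polynomial-size circuit, and consequently
  `O ∈ P/poly`", for every well-formed content assignment.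

## Design notes

* The separating language of the Barriers file is `{x : N₀ ≤ |x| ∧ (C |x|).isPerm}` (all strings
  of a good length rather than the printed unary `0ⁿ`; the separation `BPP^O ≠ BQP^O` is the same
  statement).
* `levelStrings n j f` only reads `f` on `{0,1}^j`; bit `i ≥ |f x|` reads as `0` (`List.getD`).
* The three facts quantify over an arbitrary probe bound `B` (a polynomial dominating the block
  lengths in use: `ℓ n ≤ B n` for `prp`/`prfmod` levels, `n ≤ B n` for fillers); the machines may
  depend on `B`.
* In `aaronsonChen2017_lem75_quantum` the oracle is any language agreeing with
  `levelStrings n j f` on `levelDomain n`: the family only queries level-`n` strings. The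
  threshold `n₀ ≥ N₁` below which the family rejects is a parameter (the printed "hardwire the
  values of `n` on which `M^O` is incorrect").
* In `aaronsonChen2017_thm76_bppMachine` the simulated run is the one of
  `Literature.Computability.QuantumComplexity.baseLang` (oracle cut off at the query bound `q(|z|)`,
  fuel `q(|z|)`), written out so that this file need not import the Raz–Tal files; for a genuine
  `P^O` machine the cut-off is invisible (`baseLang_eq_of_PRel` there).

## Sources

* [AaronsonChen2017] arXiv:1612.05903: §7.2 and Lemma 7.5 (pp. 29–30), Thm. 7.6 and its proof
  (p. 30), App. 13 (proof of Lemma 7.5, p. 42).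
* [BonehLipton1995] D. Boneh, R. Lipton, *Quantum cryptanalysis of hidden linear functions*,
  CRYPTO '95 (the period-finding algorithm invoked in App. 13; cited through [AaronsonChen2017]).
* [AroraBarak2009] S. Arora, B. Barak, *Computational Complexity*, §3.4 (oracle machines),
  Def. 7.3 (`BPP` via random strings), §6.1 (`P/poly`).
-/

namespace Literature.Computability.Cryptography

open Filter Asymptotics _root_.Computability Complexity

/-! ### The encoding of one level -/

/-- The level-`n` **announcement string** for the index `i`: `boolPair 1ⁿ (0 · 1ⁱ)`. It belongs to
the oracle iff `i < j`, where `j` is the block length of level `n` (so the machines can read `j`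
off the oracle). [cite: AaronsonChen2017, Thm. 7.6 (proof, p. 30: "the oracle will encode the truth tables")] -/
def ancStr (n i : ℕ) : List Bool :=
  boolPair (unaryEncodeNat n) (false :: unaryEncodeNat i)

/-- The level-`n` **value string** for the point `x` and the bit index `i`:
`boolPair 1ⁿ (1 · boolPair x 1ⁱ)`. It belongs to the oracle iff `|x| = j`, `i < j` and bit `i` of
`f_n(x)` is `1` ("the oracle `O` will encode the truth tables of functions `f₁, f₂, …`").
[cite: AaronsonChen2017, Thm. 7.6 (proof, p. 30)] -/
def qryStr (n : ℕ) (x : List Bool) (i : ℕ) : List Bool :=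
  boolPair (unaryEncodeNat n) (true :: boolPair x (unaryEncodeNat i))

/-- The strings addressed to level `n`: those of the form `boolPair 1ⁿ rest`. [folklore] -/
def levelDomain (n : ℕ) : Set (List Bool) :=
  Set.range fun rest : List Bool => boolPair (unaryEncodeNat n) rest

/-- **The level-`n` block of the oracle** for block length `j` and level function `f`: the
announcements `ancStr n i`, `i < j`, and the value strings `qryStr n x i` with `|x| = j`, `i < j`
and bit `i` of `f x` set (the truth table of `f` on `{0,1}^j`, bit by bit).
[cite: AaronsonChen2017, Thm. 7.6 (proof, p. 30)] -/
def levelStrings (n j : ℕ) (f : List Bool → List Bool) : Set (List Bool) :=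
  {w | (∃ i, i < j ∧ w = ancStr n i) ∨
    ∃ (x : List Bool) (i : ℕ), x.length = j ∧ i < j ∧ (f x).getD i false = true ∧ w = qryStr n x i}

/-- Announcement strings determine their level and index (`boolPair` and `unaryEncodeNat` are
injective: `QCircuit.boolPair_inj`, `QCircuit.unaryEncodeNat_injective`). [folklore] -/
theorem ancStr_eq_ancStr_iff {n i n' i' : ℕ} : ancStr n i = ancStr n' i' ↔ n = n' ∧ i = i' := by
  constructor
  · intro h
    obtain ⟨h1, h2⟩ := QCircuit.boolPair_inj h
    exact ⟨QCircuit.unaryEncodeNat_injective h1,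
      QCircuit.unaryEncodeNat_injective (List.cons_eq_cons.1 h2).2⟩
  · rintro ⟨rfl, rfl⟩
    rfl

/-- Value strings determine their level, point and bit index. [folklore] -/
theorem qryStr_eq_qryStr_iff {n n' : ℕ} {x x' : List Bool} {i i' : ℕ} :
    qryStr n x i = qryStr n' x' i' ↔ n = n' ∧ x = x' ∧ i = i' := by
  constructor
  · intro h
    obtain ⟨h1, h2⟩ := QCircuit.boolPair_inj h
    obtain ⟨h3, h4⟩ := QCircuit.boolPair_inj (List.cons_eq_cons.1 h2).2
    exact ⟨QCircuit.unaryEncodeNat_injective h1, h3, QCircuit.unaryEncodeNat_injective h4⟩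
  · rintro ⟨rfl, rfl, rfl⟩
    rfl

/-- Announcement strings and value strings are distinct (tag bit). [folklore] -/
theorem ancStr_ne_qryStr (n i n' : ℕ) (x : List Bool) (i' : ℕ) : ancStr n i ≠ qryStr n' x i' := by
  intro h
  have h2 := (List.cons_eq_cons.1 (QCircuit.boolPair_inj h).2).1
  exact Bool.false_ne_true h2

/-- Announcement strings of level `n` are addressed to level `n`. [folklore] -/
theorem ancStr_mem_levelDomain (n i : ℕ) : ancStr n i ∈ levelDomain n :=
  ⟨_, rfl⟩

/-- Value strings of level `n` are addressed to level `n`. [folklore] -/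
theorem qryStr_mem_levelDomain (n : ℕ) (x : List Bool) (i : ℕ) : qryStr n x i ∈ levelDomain n :=
  ⟨_, rfl⟩

/-- The level-`n` block lies in the level-`n` domain. [folklore] -/
theorem levelStrings_subset_levelDomain (n j : ℕ) (f : List Bool → List Bool) :
    levelStrings n j f ⊆ levelDomain n := by
  rintro w (⟨i, -, rfl⟩ | ⟨x, i, -, -, -, rfl⟩)
  · exact ancStr_mem_levelDomain n i
  · exact qryStr_mem_levelDomain n x i

/-- Level domains are pairwise disjoint: a string is addressed to at most one level. [folklore] -/
theorem eq_of_mem_levelDomain {n n' : ℕ} {w : List Bool} (h : w ∈ levelDomain n)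
    (h' : w ∈ levelDomain n') : n = n' := by
  obtain ⟨r, rfl⟩ := h
  obtain ⟨r', hr'⟩ := h'
  exact (QCircuit.unaryEncodeNat_injective (QCircuit.boolPair_inj hr').1).symm

/-- A string addressed to level `n` is longer than `2n + 1` (the prefix `1ⁿ` is doubled by
`boolPair`); in particular strings of length `≤ R` are addressed to levels `< R`. [folklore] -/
theorem length_of_mem_levelDomain {n : ℕ} {w : List Bool} (h : w ∈ levelDomain n) :
    2 * n + 2 ≤ w.length := by
  obtain ⟨r, rfl⟩ := h
  rw [length_boolPair]
  have : (unaryEncodeNat n).length = n := by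
    induction n with
    | zero => rfl
    | succ n ih => simp [unaryEncodeNat, ih]
  omega

/-- Strings of a level block are longer than twice the level. [folklore] -/
theorem length_of_mem_levelStrings {n j : ℕ} {f : List Bool → List Bool} {w : List Bool}
    (h : w ∈ levelStrings n j f) : 2 * n + 2 ≤ w.length :=
  length_of_mem_levelDomain (levelStrings_subset_levelDomain n j f h)

/-- Membership of an announcement string in a level block: `ancStr n i ∈ levelStrings n j f ↔ i < j`.
[cite: AaronsonChen2017, Thm. 7.6 (proof, p. 30)] -/
@[simp] theorem ancStr_mem_levelStrings_iff {n i j : ℕ} {f : List Bool → List Bool} :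
    ancStr n i ∈ levelStrings n j f ↔ i < j := by
  constructor
  · rintro (⟨i', hi', h⟩ | ⟨x, i', -, -, -, h⟩)
    · rw [(ancStr_eq_ancStr_iff.1 h).2]; exact hi'
    · exact absurd h (ancStr_ne_qryStr n i n x i')
  · exact fun h => Or.inl ⟨i, h, rfl⟩

/-- Membership of a value string in a level block:
`qryStr n x i ∈ levelStrings n j f ↔ |x| = j ∧ i < j ∧ (f x)ᵢ = 1`. [cite: AaronsonChen2017, Thm. 7.6 (proof, p. 30)] -/
@[simp] theorem qryStr_mem_levelStrings_iff {n j : ℕ} {f : List Bool → List Bool} {x : List Bool}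
    {i : ℕ} : qryStr n x i ∈ levelStrings n j f ↔ x.length = j ∧ i < j ∧ (f x).getD i false = true := by
  constructor
  · rintro (⟨i', -, h⟩ | ⟨x', i', hx', hi', hb, h⟩)
    · exact absurd h.symm (ancStr_ne_qryStr n i' n x i)
    · obtain ⟨-, rfl, rfl⟩ := qryStr_eq_qryStr_iff.1 h
      exact ⟨hx', hi', hb⟩
  · rintro ⟨hx, hi, hb⟩
    exact Or.inr ⟨x, i, hx, hi, hb, rfl⟩

/-- An announcement string of another level is not in the block. [folklore] -/
theorem ancStr_mem_levelStrings_of_ne {n n' i j : ℕ} {f : List Bool → List Bool} (h : n ≠ n') :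
    ancStr n' i ∉ levelStrings n j f := fun hm =>
  h (eq_of_mem_levelDomain (levelStrings_subset_levelDomain n j f hm) (ancStr_mem_levelDomain n' i))

/-- A value string of another level is not in the block. [folklore] -/
theorem qryStr_mem_levelStrings_of_ne {n n' j : ℕ} {f : List Bool → List Bool} {x : List Bool}
    {i : ℕ} (h : n ≠ n') : qryStr n' x i ∉ levelStrings n j f := fun hm =>
  h (eq_of_mem_levelDomain (levelStrings_subset_levelDomain n j f hm) (qryStr_mem_levelDomain n' x i))

/-- A level block only reads the level function on `{0,1}^j`. [folklore] -/
theorem levelStrings_congr {n j : ℕ} {f g : List Bool → List Bool}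
    (h : ∀ x : List Bool, x.length = j → f x = g x) : levelStrings n j f = levelStrings n j g := by
  ext w
  simp only [levelStrings, Set.mem_setOf_eq]
  refine or_congr_right (exists_congr fun x => exists_congr fun i => ?_)
  constructor
  · rintro ⟨hx, hi, hb, hw⟩
    exact ⟨hx, hi, by rw [← h x hx]; exact hb, hw⟩
  · rintro ⟨hx, hi, hb, hw⟩
    exact ⟨hx, hi, by rw [h x hx]; exact hb, hw⟩

/-- **A level block is a finite set** (finitely many announcements, and finitely many value
strings: `x ∈ {0,1}^j`, `i < j`). [folklore] -/
theorem levelStrings_finite (n j : ℕ) (f : List Bool → List Bool) : (levelStrings n j f).Finite := by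
  refine (((Set.finite_lt_nat j).image fun i => ancStr n i).union
    (((List.finite_length_eq Bool j).prod (Set.finite_lt_nat j)).image
      fun p : List Bool × ℕ => qryStr n p.1 p.2)).subset ?_
  rintro w (⟨i, hi, rfl⟩ | ⟨x, i, hx, hi, -, rfl⟩)
  · exact Or.inl ⟨i, hi, rfl⟩
  · exact Or.inr ⟨(x, i), ⟨hx, hi⟩, rfl⟩

/-! ### Level contents: `PRP^raw_k`, `PRF^mod_{(k,a)}`, or the filler -/

/-- **What a level of the oracle carries**: the raw pseudorandom permutation under the key `k`
(`f_n = PRP^raw_k` on `{0,1}^{ℓ n}`), Zhandry's modified function under the key `(k, a)`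
(`f_n = PRF^mod_{(k,a)}`), or — at the levels the diagonalization does not treat — the *filler*,
the identity permutation of `{0,1}ⁿ` (block length `n`). [cite: AaronsonChen2017, Thm. 7.6 (proof, p. 30)] -/
inductive LevelContent : Type
  /-- The identity permutation of `{0,1}ⁿ` (an untreated level). -/
  | filler : LevelContent
  /-- `f_n = PRP^raw_k`. -/
  | prp (k : List Bool) : LevelContent
  /-- `f_n = PRF^mod_{(k,a)}`. -/
  | prfmod (k : List Bool) (a : ℕ) : LevelContent

namespace LevelContent

/-- The world bit of a level: `1` iff its function is a permutation (`filler`, `prp`); the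
separating language is the set of lengths with world bit `1` ("all `0ⁿ` for which `f_n` is drawn
from `PRP^raw`"). [cite: AaronsonChen2017, Thm. 7.6 (proof, p. 30)] -/
def isPerm : LevelContent → Bool
  | filler => true
  | prp _ => true
  | prfmod _ _ => false

/-- The block length of a level: `ℓ n` for the cryptographic contents, `n` for the filler.
[cite: AaronsonChen2017, §7.2 (p. 29, "domain `[N]`, `N = N(n)`")] -/
def blockLen (ℓ : ℕ → ℕ) (n : ℕ) : LevelContent → ℕ
  | filler => n
  | prp _ => ℓ n
  | prfmod _ _ => ℓ n

/-- The level function: the identity, `PRP^raw_k = F n k`, or `PRF^mod_{(k,a)} = prfMod F ℓ n k a`.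
[cite: AaronsonChen2017, §7.2 and Thm. 7.6 (proof, p. 30)] -/
def fn (F : FunctionEnsemble) (ℓ : ℕ → ℕ) (n : ℕ) : LevelContent → List Bool → List Bool
  | filler => id
  | prp k => F n k
  | prfmod k a => prfMod F ℓ n k a

/-- Well-formed contents: keys of the key length `κ n`, moduli from Zhandry's set `A` for the
domain size `2^{ℓ n}`. [cite: AaronsonChen2017, §7.2 (p. 29)] -/
def WellFormed (κ ℓ : ℕ → ℕ) (n : ℕ) : LevelContent → Prop
  | filler => True
  | prp k => k.length = κ n
  | prfmod k a => k.length = κ n ∧ a ∈ zhandryModuli (2 ^ ℓ n)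

/-- The filler is a permutation level. [folklore] -/
@[simp] theorem isPerm_filler : filler.isPerm = true := rfl

/-- `PRP^raw` levels are permutation levels. [cite: AaronsonChen2017, Thm. 7.6 (proof, p. 30)] -/
@[simp] theorem isPerm_prp (k : List Bool) : (prp k).isPerm = true := rfl

/-- `PRF^mod` levels are not permutation levels. [cite: AaronsonChen2017, §7.2 (p. 29)] -/
@[simp] theorem isPerm_prfmod (k : List Bool) (a : ℕ) : (prfmod k a).isPerm = false := rfl

/-- The filler has block length `n`. [folklore] -/
@[simp] theorem blockLen_filler (ℓ : ℕ → ℕ) (n : ℕ) : filler.blockLen ℓ n = n := rfl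

/-- `PRP^raw` levels have block length `ℓ n`. [cite: AaronsonChen2017, §7.2 (p. 29)] -/
@[simp] theorem blockLen_prp (ℓ : ℕ → ℕ) (n : ℕ) (k : List Bool) : (prp k).blockLen ℓ n = ℓ n := rfl

/-- `PRF^mod` levels have block length `ℓ n`. [cite: AaronsonChen2017, §7.2 (p. 29)] -/
@[simp] theorem blockLen_prfmod (ℓ : ℕ → ℕ) (n : ℕ) (k : List Bool) (a : ℕ) :
    (prfmod k a).blockLen ℓ n = ℓ n := rfl

/-- The filler function is the identity. [folklore] -/
@[simp] theorem fn_filler (F : FunctionEnsemble) (ℓ : ℕ → ℕ) (n : ℕ) : filler.fn F ℓ n = id := rfl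

/-- The function of a `PRP^raw` level. [cite: AaronsonChen2017, §7.2 (p. 29)] -/
@[simp] theorem fn_prp (F : FunctionEnsemble) (ℓ : ℕ → ℕ) (n : ℕ) (k : List Bool) :
    (prp k).fn F ℓ n = F n k := rfl

/-- The function of a `PRF^mod` level. [cite: AaronsonChen2017, §7.2 (p. 29)] -/
@[simp] theorem fn_prfmod (F : FunctionEnsemble) (ℓ : ℕ → ℕ) (n : ℕ) (k : List Bool) (a : ℕ) :
    (prfmod k a).fn F ℓ n = prfMod F ℓ n k a := rfl

/-- The filler is well formed. [folklore] -/
@[simp] theorem wellFormed_filler (κ ℓ : ℕ → ℕ) (n : ℕ) : filler.WellFormed κ ℓ n := trivial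

/-- Well-formedness of a `PRP^raw` level: the key has length `κ n`. [cite: AaronsonChen2017, Def. 7.1 (p. 29)] -/
@[simp] theorem wellFormed_prp_iff (κ ℓ : ℕ → ℕ) (n : ℕ) (k : List Bool) :
    (prp k).WellFormed κ ℓ n ↔ k.length = κ n := Iff.rfl

/-- Well-formedness of a `PRF^mod` level: key of length `κ n`, modulus in `A`.
[cite: AaronsonChen2017, §7.2 (p. 29)] -/
@[simp] theorem wellFormed_prfmod_iff (κ ℓ : ℕ → ℕ) (n : ℕ) (k : List Bool) (a : ℕ) :
    (prfmod k a).WellFormed κ ℓ n ↔ k.length = κ n ∧ a ∈ zhandryModuli (2 ^ ℓ n) := Iff.rfl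

/-- The level block carried by a content at level `n`. [cite: AaronsonChen2017, Thm. 7.6 (proof, p. 30)] -/
def strings (F : FunctionEnsemble) (ℓ : ℕ → ℕ) (n : ℕ) (c : LevelContent) : Set (List Bool) :=
  levelStrings n (c.blockLen ℓ n) (c.fn F ℓ n)

/-- The block of a content lies in the level domain. [folklore] -/
theorem strings_subset_levelDomain (F : FunctionEnsemble) (ℓ : ℕ → ℕ) (n : ℕ) (c : LevelContent) :
    c.strings F ℓ n ⊆ levelDomain n :=
  levelStrings_subset_levelDomain _ _ _

/-- The block of a content is finite. [folklore] -/
theorem strings_finite (F : FunctionEnsemble) (ℓ : ℕ → ℕ) (n : ℕ) (c : LevelContent) :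
    (c.strings F ℓ n).Finite :=
  levelStrings_finite _ _ _

end LevelContent

/-! ### The oracle of a content assignment, and the oracle seen by a stage -/

/-- **The oracle of Thm. 7.6** for the content assignment `C : ℕ → LevelContent`: the union over
the levels `n` of the blocks `(C n).strings F ℓ n` — the truth tables of `f₁, f₂, …` with their
block lengths announced. [cite: AaronsonChen2017, Thm. 7.6 (proof, p. 30)] -/
def zhandryOracle (F : FunctionEnsemble) (ℓ : ℕ → ℕ) (C : ℕ → LevelContent) : Language Bool :=
  {w | ∃ n, w ∈ (C n).strings F ℓ n}

/-- On the level-`n` domain the oracle is the level-`n` block. [folklore] -/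
theorem mem_zhandryOracle_iff_of_mem_levelDomain (F : FunctionEnsemble) (ℓ : ℕ → ℕ)
    (C : ℕ → LevelContent) {n : ℕ} {w : List Bool} (hw : w ∈ levelDomain n) :
    w ∈ zhandryOracle F ℓ C ↔ w ∈ (C n).strings F ℓ n := by
  constructor
  · rintro ⟨n', hn'⟩
    have : n' = n :=
      eq_of_mem_levelDomain ((C n').strings_subset_levelDomain F ℓ n' hn') hw
    subst this
    exact hn'
  · exact fun h => ⟨n, h⟩

/-- Every oracle string is addressed to some level, whose block it belongs to. [folklore] -/
theorem mem_zhandryOracle_iff (F : FunctionEnsemble) (ℓ : ℕ → ℕ) (C : ℕ → LevelContent)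
    (w : List Bool) : w ∈ zhandryOracle F ℓ C ↔ ∃ n, w ∈ (C n).strings F ℓ n :=
  Iff.rfl

/-- Changing the contents at levels `≥ R` does not change the oracle on strings of length `≤ R`
(a level-`m` string is longer than `2m + 1`). [folklore] -/
theorem mem_zhandryOracle_congr (F : FunctionEnsemble) (ℓ : ℕ → ℕ) {C C' : ℕ → LevelContent} {R : ℕ}
    (h : ∀ m, m < R → C m = C' m) {w : List Bool} (hw : w.length ≤ R) :
    w ∈ zhandryOracle F ℓ C ↔ w ∈ zhandryOracle F ℓ C' := by
  constructor
  · rintro ⟨m, hm⟩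
    have hlt : m < R := by
      have := length_of_mem_levelStrings hm
      omega
    exact ⟨m, by rw [← h m hlt]; exact hm⟩
  · rintro ⟨m, hm⟩
    have hlt : m < R := by
      have := length_of_mem_levelStrings hm
      omega
    exact ⟨m, by rw [h m hlt]; exact hm⟩

/-- **The oracle seen by a stage of the diagonalization**, as a function of the level-`n` data
`(j, f)`: a finite hard-wired set `T` of strings (the blocks of the finitely many treated levels
`E`), the block `levelStrings n j f` of the level `n ∉ E` under test, and the filler blocks
`levelStrings m m id` at all other levels `m ∉ E`, `m ≠ n`.
[cite: AaronsonChen2017, Thm. 7.6 (proof, p. 30)] -/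
def specLang (E : Finset ℕ) (T : Finset (List Bool)) (n j : ℕ) (f : List Bool → List Bool) :
    Language Bool :=
  {w | w ∈ T ∨ w ∈ levelStrings n j f ∨ ∃ m, m ∉ E ∧ m ≠ n ∧ w ∈ levelStrings m m id}

/-- Unfolding lemma for `specLang`. [folklore] -/
theorem mem_specLang_iff {E : Finset ℕ} {T : Finset (List Bool)} {n j : ℕ}
    {f : List Bool → List Bool} {w : List Bool} :
    w ∈ specLang E T n j f ↔
      w ∈ T ∨ w ∈ levelStrings n j f ∨ ∃ m, m ∉ E ∧ m ≠ n ∧ w ∈ levelStrings m m id :=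
  Iff.rfl

/-! ### The three leaves -/

/-- **Aaronson–Chen 2017, Lemma 7.5 (2)–(3), in the `BQP^O` model** (App. 13: Boneh–Lipton period
finding recovers the period `a` of `f = g_{mod a}` for a permutation `g`, "using a polynomial
number of repetitions"; the distinguisher "accepts only if `f(1) = f(1 + a)`", and "when
`f ← PRP^raw`, `f` is a permutation, which means `A` accepts with probability `0`"), uniformly in
the key as the printed proof establishes it, together with the hard-wiring of small lengths of the
proof of Thm. 7.6. For every polynomial probe bound `B` there is a threshold `N₁` such that for
every `n₀ ≥ N₁` some poly-time uniform family `D` of Clifford+T circuits with oracle gates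
(`QCircuitFamily.IsUniform`, acceptance `acceptProbOn` = measuring wire `0`) satisfies: on inputs
of length `< n₀` it accepts with probability `≤ 1/3`; on an input `x` of length `n ≥ n₀`, for every
block length `j ∈ [n, B n]`, every length-preserving level function `f` on `{0,1}^j` and every
oracle language `O` whose level-`n` block is `levelStrings n j f`: (i) if `f` is injective on
`{0,1}^j` then `D` accepts `x` with probability `≥ 2/3` (no collision exists); (ii) if
`f = g ∘ modReduce j a` on `{0,1}^j` for some `g` injective on `{0,1}^j` and some modulus
`a ∈ zhandryModuli (2^j)` then `D` accepts `x` with probability `≤ 1/3` (the period is found and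
the collision `f(0) = f(a)` confirmed). Named fact: its discharge is a uniform oracle circuit
family for period finding over `ℤ_{2^j}` with its analysis in the tree's Q2 model.
[cite: AaronsonChen2017, Lemma 7.5 (2)–(3) (p. 30) and App. 13 (p. 42); Thm. 7.6 (proof, p. 30: "hardwire")]
[cite: BonehLipton1995] [cite: Zhandry2012, Claim 2] -/
def aaronsonChen2017_lem75_quantum : Prop :=
  ∀ B : Polynomial ℕ, ∃ N₁ : ℕ, ∀ n₀ : ℕ, N₁ ≤ n₀ →
    ∃ D : QCircuitFamily cliffordT, D.IsUniform ∧
      (∀ (O : Language Bool) (x : List Bool), x.length < n₀ → D.acceptProbOn O x ≤ 1 / 3) ∧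
      ∀ (O : Language Bool) (x : List Bool), n₀ ≤ x.length →
        ∀ (j : ℕ) (f : List Bool → List Bool), x.length ≤ j → j ≤ B.eval x.length →
          (∀ y : List Bool, y.length = j → (f y).length = j) →
          (∀ w ∈ levelDomain x.length, w ∈ O ↔ w ∈ levelStrings x.length j f) →
            (Set.InjOn f {y : List Bool | y.length = j} → 2 / 3 ≤ D.acceptProbOn O x) ∧
            ((∃ (g : List Bool → List Bool) (a : ℕ), a ∈ zhandryModuli (2 ^ j) ∧
                Set.InjOn g {y : List Bool | y.length = j} ∧
                  ∀ y : List Bool, y.length = j → f y = g (modReduce j a y)) →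
              D.acceptProbOn O x ≤ 1 / 3)

/-- **Aaronson–Chen 2017, proof of Thm. 7.6: "let `M` be a `BPP` machine" — a `BPP^O` machine at
the probe `1ⁿ` is a probabilistic polynomial-time oracle adversary against the level-`n`
function.** For every polynomial-time oracle algorithm `M` (G01 transcript model) with
round/query bound `q` and coin polynomial `p`, every probe bound `B`, every finite set `E` of
levels and finite set `T` of hard-wired strings, there is a PPT oracle adversary `𝒜`
(C4a `OracleAdversary`, the adversaries of `IsPRP`/`IsPRF`) such that for every level `n ∉ E`,
every block length `j ∈ [1, B n]` and every length-preserving `f` on `{0,1}^j`, the probability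
that `𝒜`, given `1ⁿ` and oracle access to `f` on queries of length `j` (`oracleOfFnAt j f`),
outputs `1` equals the probability over `r ∈ {0,1}^{p(n)}` that `M`, run for `q(|z|)` rounds on
`z = ⟨1ⁿ, r⟩` against the oracle language `specLang E T n j f` cut off at query length `q(|z|)`,
accepts. (`𝒜` reads `j` off its oracle by probing the lengths `1, …, B n`, answers `M`'s queries at
level `n` through its oracle, the strings of `T` and the filler levels by itself; folklore
simulation of oracle machines, made uniform by the finite hard-wiring.) Named fact (a machine
construction in the tree's `TM2`-based `PolyTimeComputable`).
[cite: AaronsonChen2017, Thm. 7.6 (proof, p. 30)] [cite: AroraBarak2009, §3.4 and Def. 7.3] -/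
def aaronsonChen2017_thm76_bppMachine : Prop :=
  ∀ (M : OracleAlg Bool), M.IsPolyTime encodingBoolBool →
    ∀ (q p B : Polynomial ℕ) (E : Finset ℕ) (T : Finset (List Bool)),
      ∃ 𝒜 : OracleAdversary Bool, 𝒜.IsPPT encodingBoolBool ∧
        ∀ (n j : ℕ) (f : List Bool → List Bool), n ∉ E → 1 ≤ j → j ≤ B.eval n →
          (∀ y : List Bool, y.length = j → (f y).length = j) →
          𝒜.acceptProb (oracleOfFnAt j f) n =
            uniformProb (p.eval n) {r : List Bool |
              M.run (Oracle.ofLanguage {s : List Bool | s ∈ specLang E T n j f ∧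
                  s.length ≤ q.eval (boolPair (unaryEncodeNat n) r).length})
                (q.eval (boolPair (unaryEncodeNat n) r).length) (boolPair (unaryEncodeNat n) r) =
                some true}

/-- **Aaronson–Chen 2017, proof of Thm. 7.6: "each `f_n` has a polynomial-size circuit, and
consequently `O ∈ P/poly`."** For an efficiently computable family `F` with key and block lengths
`κ, ℓ` (`IsEfficientFamily F κ ℓ ℓ`) and every well-formed content assignment `C` (keys of length
`κ n`, moduli in `A ⊆ [0, 2^{ℓ n}]`), the oracle `zhandryOracle F ℓ C` is decided by a
polynomial-size family of `B₂`-circuits (`PPoly`): at input length `m` only the levels `n < m / 2`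
occur, and for each the announcement and value strings are decided by the polynomial-size circuits
of `F n k` (`P ⊆ P/poly`, Arora–Barak Thm. 6.6) and of reduction modulo `a`, with `n`, `ℓ n`, `k`,
`a` as advice. Named fact. [cite: AaronsonChen2017, Thm. 7.6 (proof, p. 30)] [cite: AroraBarak2009, Thm. 6.6 and Def. 6.5] -/
def aaronsonChen2017_thm76_memPPoly : Prop :=
  ∀ (F : FunctionEnsemble) (κ ℓ : ℕ → ℕ), IsEfficientFamily F κ ℓ ℓ →
    ∀ C : ℕ → LevelContent, (∀ n, (C n).WellFormed κ ℓ n) → zhandryOracle F ℓ C ∈ PPoly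

end Literature.Computability.Cryptography
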